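import Mathlib.Analysis.Calculus.MeanValue
import Mathlib.MeasureTheory.Integral.IntervalIntegral.FundThmCalculus
import Literature.Analysis.FluidPDE.PeriodicGalileanNonuniqueness
import Literature.Analysis.FluidPDE.ClassicalSolutionGalileanLocal
import Literature.Analysis.Calculus.SeeleyExtension
import HarnessLib

/-!
# Pressure normalisation for space-periodic smooth Navier–Stokes solutions
# (Tao 2013, Lemma 4.1 (ii) and the Galilean symmetry of §3; Fefferman's (10) vs the CMI erratum)

Literature file (topic `Analysis/FluidPDE`; every statement is a theorem, no named facts).
Source: T. Tao, *Localisation and compactness properties of the Navier–Stokes global regularity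
problem*, Anal. PDE 6 (2013) 25–107 = arXiv:1108.1165 [Tao2013Localisation] (arXiv numbering:
Lemma 25 = journal Lemma 4.1; §3 eq. (galilean); footnote to (1.8)); C. L. Fefferman, *Existence and
smoothness of the Navier–Stokes equation*, CMI 2000/2006 [FeffermanClay2006], statements (B), (D),
condition (10) ("`u(x,t) = u(x + eⱼ, t)` on `ℝ³ × [0,∞)`", the pressure unconstrained as printed) and
the errata page of the CMI offprint ("The further condition `p(x + eⱼ, t) = p(x, t)` should be made
explicit").

## What is printed

* Tao 2013, Lemma 4.1 (ii) (arXiv Lemma 25): for a smooth periodic solution `(u, p, u₀, f, T)` the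
  pressure is the normalised pressure up to a linear-plus-constant correction,
  `p(t, x) = −Δ⁻¹ ∂ᵢ∂ⱼ(uᵢuⱼ)(t, x) + Δ⁻¹ ∇·f(t, x) + x · a(t) + C(t)`; the part used below is the
  elementary half of it: *a smooth function on `ℝ³` with `ℤ³`-periodic GRADIENT is a periodic
  function plus a linear function `x · a` plus a constant*, and for a solution with periodic
  velocity (and periodic force) the momentum equation (1) makes `∇p(·, t)` periodic.
* Tao 2013, §3 eq. (galilean) and §1 after Prop. 1.7 / footnote to eq. (1.8): the Galilean
  symmetry `ũ(t,x) = u(t, x − ∫₀ᵗ v) + v(t)`, `p̃(t,x) = p(t, x − ∫₀ᵗ v) − x · v′(t)` maps smooth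
  periodic solutions to smooth periodic solutions with the same datum when `v(0) = 0`, and "this
  symmetry is in some sense degenerate" — it is exactly what separates Fefferman's printed
  condition (10) from the errata reading; normalised pressure "is equivalent to requiring that the
  pressure be periodic with the same period as the solution `u`".

## What is formalised

For the UNFORCED system (or a force periodic in `x` for `t ≥ 0`) on `ℝ^ι × [0,∞)` in the wave-0
sense of the tree (`IsNavierStokesSolution ν f u₀ u p`, `IsSmoothOnHalfSpace u`, `IsSmoothOnHalfSpace p`)
with `u(·, t)` `ℤ^ι`-periodic for every `t ≥ 0`:
* `IsNavierStokesSolution.isLatticePeriodic_gradient_pressure` — `∇p(·,t)` is periodic, `t ≥ 0`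
  (read off the momentum equation (1): every other term is periodic);
* `pressureDrift p t = ∑ⱼ (p(t, eⱼ) − p(t, 0)) eⱼ` and
  `IsNavierStokesSolution.isLatticePeriodic_pressure_sub_inner` — `p(·,t) − ⟪pressureDrift p t, ·⟫`
  is periodic (Lemma 4.1 (ii), elementary half: a smooth function with periodic gradient is periodic
  plus linear; `is_const_of_fderiv_eq_zero`);
* `contDiffOn_pressureDrift` — `t ↦ pressureDrift p t` is `C^∞` on `[0,∞)` (one-sided), and
  `exists_contDiff_extension_Ici` — a `C^∞` function on `[0,∞)` extends to a `C^∞` function on `ℝ`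
  (the tree's Seeley extension `Literature.Analysis.Calculus.Seeley.contDiffOn_extend`);
* **`IsNavierStokesSolution.exists_pressurePeriodic_of_velocityPeriodic`** — THE BRIDGE: boosting by
  the frame `ξ` with `ξ″ = −(extended drift)`, `ξ(0) = ξ′(0) = 0` (the tree's
  `IsNavierStokesSolution.galileanBoost`, `PeriodicGalileanNonuniqueness.lean`) produces, from a
  solution smooth on `ℝ^ι × [0,∞)` with the SAME viscosity, the SAME datum, periodic VELOCITY and
  unconstrained pressure, a solution smooth on `ℝ^ι × [0,∞)` with periodic velocity AND periodic
  PRESSURE (the force `f` becomes `f(t, · + ξ(t))`; `f ≡ 0` stays `0`: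
  `exists_pressurePeriodic_of_velocityPeriodic_zero`). Consequently, for `f ≡ 0`, solvability of a
  periodic Cauchy problem in Fefferman's printed class (10) and in the CMI-errata class (pressure
  periodic too) are EQUIVALENT (`exists_velocityPeriodic_iff_exists_pressurePeriodic`); the
  Clay-schema corollaries ((B) ⇔ errata-(B); an unforced errata-class counterexample at one
  viscosity proves printed (D)) are drawn in `Literature/Claims/NS/ClayVariants.lean`.

* LOCAL-IN-TIME form (classical solutions on `[0, T)`, the shape of a blow-up solution):
  `IsClassicalNSSolutionOn.isLatticePeriodic_gradient_pressure`,
  `IsClassicalNSSolutionOn.isLatticePeriodic_pressure_sub_inner`,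
  `IsClassicalNSSolutionOn.contDiffOn_pressureDrift` on any time set `S`, the extension
  `exists_contDiffOn_extension_Ico` (`[0,T)` to the open `(−∞, T)`, Seeley with `δ = T`), and
  **`IsClassicalNSSolutionOn.exists_pressurePeriodic_of_velocityPeriodic_Ico`** (`_zero`): a
  classical solution on `ℝ^ι × [0,T)` with periodic velocity slices is boosted (frame smooth on
  `(−∞, T)`, tree `IsClassicalNSSolutionOn.galileanBoostOn`) to one on `[0,T)` with the same
  time-`0` slice and periodic velocity AND pressure — the normalisation needed to compare a
  blow-up solution with a global one (uniqueness holds in the errata class only).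

Not formalised: the other half of Lemma 4.1 (ii) (identification of the periodic part with the
NORMALISED pressure `−Δ⁻¹∂ᵢ∂ⱼ(uᵢuⱼ)` up to `C(t)`, which needs Liouville's theorem for periodic
harmonic functions), and Prop. 1.7 (elimination of a forcing term), which changes the force.

## References

* [Tao2013Localisation] T. Tao, Anal. PDE 6 (2013) 25–107, arXiv:1108.1165: Lemma 4.1 (ii)
  (arXiv Lemma 25), §3 eq. (galilean), §1 after Prop. 1.7, footnote to (1.8).
* [FeffermanClay2006] C. L. Fefferman, Existence and smoothness of the Navier–Stokes equation, CMI
  (2000/2006): (B), (D), (10), errata page of the offprint.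

WHAT THIS IS NOT: not a claim about NS regularity or blow-up; not a claim about any author beyond
the typed locator.
-/

noncomputable section

open Set Function Filter InnerProductSpace MeasureTheory
open scoped ContDiff RealInnerProductSpace Topology Laplacian

namespace Literature.Analysis.FluidPDE

/-! ### One-dimensional plumbing: smooth extension from `[0,∞)` and primitives -/

section OneDim

variable {F : Type*} [NormedAddCommGroup F] [NormedSpace ℝ F] [CompleteSpace F]

/-- **A `C^∞` function on the closed half-line extends to a `C^∞` function on the line** (Seeley
1964; here from the tree's slab form `Literature.Analysis.Calculus.Seeley.contDiffOn_extend` applied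
to `(t, x) ↦ c t` on `[0, 1) × ℝ`, glued with `c` itself on `(0, ∞)`). [cite: Seeley1964, Theorem] -/
theorem exists_contDiff_extension_Ici {c : ℝ → F} (hc : ContDiffOn ℝ ∞ c (Ici 0)) :
    ∃ c' : ℝ → F, ContDiff ℝ ∞ c' ∧ ∀ t, 0 ≤ t → c' t = c t := by
  set G : ℝ × ℝ → F := fun z => c z.1 with hGdef
  have hG : ContDiffOn ℝ ∞ G (Literature.Analysis.Calculus.Seeley.slab 1 (univ : Set ℝ)) := by
    refine hc.comp contDiffOn_fst fun z hz => ?_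
    exact hz.1.1
  have hext := Literature.Analysis.Calculus.Seeley.contDiffOn_extend one_pos isOpen_univ hG
  refine ⟨fun t => Literature.Analysis.Calculus.Seeley.extend 1 G (t, 0), ?_, fun t ht => ?_⟩
  · refine contDiff_iff_contDiffAt.2 fun t => ?_
    by_cases ht : t < 1
    · have h1 : ContDiffOn ℝ ∞ (fun s : ℝ => Literature.Analysis.Calculus.Seeley.extend 1 G (s, 0))
          (Iio 1) :=
        hext.comp (contDiffOn_id.prodMk contDiffOn_const) fun s hs => mk_mem_prod hs (mem_univ _)
      exact h1.contDiffAt (Iio_mem_nhds ht)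
    · have ht0 : 0 < t := by linarith
      have h2 : ContDiffOn ℝ ∞ (fun s : ℝ => Literature.Analysis.Calculus.Seeley.extend 1 G (s, 0))
          (Ioi 0) := by
        refine (hc.mono Ioi_subset_Ici_self).congr fun s hs => ?_
        exact Literature.Analysis.Calculus.Seeley.extend_of_nonneg (le_of_lt hs)
      exact h2.contDiffAt (Ioi_mem_nhds ht0)
  · exact Literature.Analysis.Calculus.Seeley.extend_of_nonneg (show (0 : ℝ) ≤ (t, (0 : ℝ)).1 from ht)

/-- The primitive `t ↦ ∫₀ᵗ φ` of a `C^∞` function is `C^∞` with derivative `φ` (fundamental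
theorem of calculus, Mathlib `intervalIntegral.integral_hasDerivAt_right`). [folklore] -/
private theorem contDiff_primitive {φ : ℝ → F} (hφ : ContDiff ℝ ∞ φ) :
    ContDiff ℝ ∞ (fun t => ∫ s in (0 : ℝ)..t, φ s) ∧
      deriv (fun t => ∫ s in (0 : ℝ)..t, φ s) = φ := by
  have hd : ∀ t, HasDerivAt (fun t => ∫ s in (0 : ℝ)..t, φ s) (φ t) t := fun t =>
    intervalIntegral.integral_hasDerivAt_right (hφ.continuous.intervalIntegrable _ _)
      (hφ.continuous.stronglyMeasurableAtFilter _ _) hφ.continuous.continuousAt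
  have hderiv : deriv (fun t => ∫ s in (0 : ℝ)..t, φ s) = φ := funext fun t => (hd t).deriv
  refine ⟨contDiff_infty_iff_deriv.2 ⟨fun t => (hd t).differentiableAt, ?_⟩, hderiv⟩
  rw [hderiv]
  exact hφ

/-- **The frame with prescribed acceleration**: for `c' : ℝ → F` of class `C^∞` there is a `C^∞`
path `ξ` with `ξ(0) = 0`, `ξ′(0) = 0` and `ξ″ = −c'` (two primitives; private plumbing). [folklore] -/
private theorem exists_frame_of_acceleration {c' : ℝ → F} (hc' : ContDiff ℝ ∞ c') :
    ∃ ξ : ℝ → F, ContDiff ℝ ∞ ξ ∧ ξ 0 = 0 ∧ deriv ξ 0 = 0 ∧ ∀ t, deriv (deriv ξ) t = -c' t := by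
  obtain ⟨hΦ, hΦ'⟩ := contDiff_primitive hc'
  obtain ⟨hΨ, hΨ'⟩ := contDiff_primitive hΦ
  have h1 : deriv (fun t => -∫ s in (0 : ℝ)..t, ∫ r in (0 : ℝ)..s, c' r) =
      fun t => -∫ r in (0 : ℝ)..t, c' r := by
    rw [deriv.fun_neg', hΨ']
  refine ⟨fun t => -∫ s in (0 : ℝ)..t, ∫ r in (0 : ℝ)..s, c' r, hΨ.neg, by simp, ?_, fun t => ?_⟩
  · rw [h1]
    simp
  · rw [h1, deriv.fun_neg', hΦ']

end OneDim

/-! ### The pressure of a solution with periodic velocity: periodic gradient, periodic + linear -/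

section PressureStructure

variable {ι : Type*} [Fintype ι] [DecidableEq ι]
variable {ν : ℝ} {f u : ℝ → EuclideanSpace ℝ ι → EuclideanSpace ℝ ι}
  {u₀ : EuclideanSpace ℝ ι → EuclideanSpace ℝ ι} {p : ℝ → EuclideanSpace ℝ ι → ℝ}

/-- **The pressure gradient of a solution with periodic velocity and periodic force is periodic**
(`t ≥ 0`): by the momentum equation (1), `∇p = νΔu + f − ∂ₜu − (u·∇)u`, and every term on the
right is `ℤ^ι`-periodic in `x` when `u(·, s)` (`s ≥ 0`) and `f(·, t)` are. (The first step of
Tao's Lemma 4.1 (ii).) [cite: Tao2013Localisation, Lemma 4.1 (ii)] -/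
theorem IsNavierStokesSolution.isLatticePeriodic_gradient_pressure
    (hns : IsNavierStokesSolution ν f u₀ u p) (hper : ∀ t, 0 ≤ t → IsLatticePeriodic (u t))
    (hfper : ∀ t, 0 ≤ t → IsLatticePeriodic (f t)) {t : ℝ} (ht : 0 ≤ t) :
    IsLatticePeriodic (gradient (p t)) := by
  intro j x
  set e : EuclideanSpace ℝ ι := EuclideanSpace.single j 1 with he
  have hshift : (fun z => u t (z + e)) = u t := funext fun z => hper t ht j z
  have hg : ∀ y, gradient (p t) y = ν • (Δ (u t)) y + f t y -
      (derivWithin (fun s => u s y) (Ici 0) t + fderiv ℝ (u t) y (u t y)) := fun y => by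
    rw [hns.momentum t ht y]
    abel
  have h1 : (Δ (u t)) (x + e) = (Δ (u t)) x := by
    rw [← laplacian_comp_add_right (u t) e x, hshift]
  have h2 : f t (x + e) = f t x := hfper t ht j x
  have h3 : derivWithin (fun s => u s (x + e)) (Ici 0) t = derivWithin (fun s => u s x) (Ici 0) t :=
    derivWithin_congr (fun s hs => hper s hs j x) (hper t ht j x)
  have h4 : fderiv ℝ (u t) (x + e) = fderiv ℝ (u t) x := by
    rw [← fderiv_comp_add_right e, hshift]
  have h5 : u t (x + e) = u t x := hper t ht j x
  rw [hg, hg, h1, h2, h3, h4, h5]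

/-- **The linear coefficient ("drift") of the pressure**: `a(t) = ∑ⱼ (p(t, eⱼ) − p(t, 0)) eⱼ`, the
vector of the increments of `p(·, t)` over the lattice generators — Tao's `a(t)` in
`p = (periodic) + x · a(t) + C(t)`. [cite: Tao2013Localisation, Lemma 4.1 (ii)] -/
def pressureDrift (p : ℝ → EuclideanSpace ℝ ι → ℝ) (t : ℝ) : EuclideanSpace ℝ ι :=
  ∑ j, (p t (EuclideanSpace.single j 1) - p t 0) • EuclideanSpace.single j 1

/-- The drift pairs with a lattice generator to the increment of the pressure over it.
[cite: Tao2013Localisation, Lemma 4.1 (ii)] -/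
theorem inner_pressureDrift_single (p : ℝ → EuclideanSpace ℝ ι → ℝ) (t : ℝ) (j : ι) :
    ⟪pressureDrift p t, EuclideanSpace.single j (1 : ℝ)⟫ =
      p t (EuclideanSpace.single j 1) - p t 0 := by
  simp [pressureDrift, sum_inner, EuclideanSpace.inner_single_right]

/-- **Lemma 4.1 (ii), elementary half: the pressure is periodic plus linear.** For a solution on
`ℝ^ι × [0,∞)` with `p` smooth on the closed half-space, periodic velocity slices and periodic force
slices, `y ↦ p(t, y) − ⟪a(t), y⟫` is `ℤ^ι`-periodic for every `t ≥ 0`, `a(t) = pressureDrift p t`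
(a smooth function with periodic gradient has constant lattice increments:
`is_const_of_fderiv_eq_zero`). [cite: Tao2013Localisation, Lemma 4.1 (ii)] -/
theorem IsNavierStokesSolution.isLatticePeriodic_pressure_sub_inner
    (hns : IsNavierStokesSolution ν f u₀ u p) (hp : IsSmoothOnHalfSpace p)
    (hper : ∀ t, 0 ≤ t → IsLatticePeriodic (u t)) (hfper : ∀ t, 0 ≤ t → IsLatticePeriodic (f t))
    {t : ℝ} (ht : 0 ≤ t) :
    IsLatticePeriodic (fun y => p t y - ⟪pressureDrift p t, y⟫) := by
  have hgrad := hns.isLatticePeriodic_gradient_pressure hper hfper ht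
  have hpt : ContDiff ℝ ∞ (p t) := IsSmoothSpaceTimeOn.contDiff_slice (S := Ici 0) hp ht
  have hpd : Differentiable ℝ (p t) := hpt.differentiable (by simp)
  intro j y
  set e : EuclideanSpace ℝ ι := EuclideanSpace.single j 1 with he
  -- the increment `d(z) = p(t, z + e) − p(t, z)` has zero derivative, hence is constant
  have hconst : p t (y + e) - p t y = p t e - p t 0 := by
    have hd1 : ∀ z, DifferentiableAt ℝ (fun z => p t (z + e)) z := fun z =>
      (hpd (z + e)).comp z (differentiableAt_id.add_const e)
    have hd : Differentiable ℝ (fun z => p t (z + e) - p t z) := fun z => (hd1 z).sub (hpd z)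
    have hd' : ∀ z, fderiv ℝ (fun z => p t (z + e) - p t z) z = 0 := fun z => by
      have hfd : fderiv ℝ (p t) (z + e) = fderiv ℝ (p t) z := by
        have hgz := hgrad j z
        change (toDual ℝ (EuclideanSpace ℝ ι)).symm (fderiv ℝ (p t) (z + e)) =
          (toDual ℝ (EuclideanSpace ℝ ι)).symm (fderiv ℝ (p t) z) at hgz
        exact (toDual ℝ (EuclideanSpace ℝ ι)).symm.injective hgz
      rw [fderiv_fun_sub (hd1 z) (hpd z), fderiv_comp_add_right e, hfd, sub_self]
    have := is_const_of_fderiv_eq_zero hd hd' y 0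
    simpa using this
  show p t (y + e) - ⟪pressureDrift p t, y + e⟫ = p t y - ⟪pressureDrift p t, y⟫
  rw [inner_add_right, inner_pressureDrift_single, ← he]
  linarith [hconst]

/-- **The drift is smooth on `[0,∞)`** (one-sided at `t = 0`): each `t ↦ p(t, y₀)` is the
composition of the jointly smooth `p` with `t ↦ (t, y₀)`. [cite: Tao2013Localisation, Lemma 4.1 (ii)] -/
theorem contDiffOn_pressureDrift (hp : IsSmoothOnHalfSpace p) :
    ContDiffOn ℝ ∞ (pressureDrift p) (Ici 0) := by
  have hline : ∀ y₀ : EuclideanSpace ℝ ι, ContDiffOn ℝ ∞ (fun t => p t y₀) (Ici 0) := fun y₀ =>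
    hp.comp (contDiffOn_id.prodMk contDiffOn_const) fun s hs => mk_mem_prod hs (mem_univ _)
  unfold pressureDrift
  exact ContDiffOn.sum fun j _ => ((hline _).sub (hline 0)).smul contDiffOn_const

end PressureStructure

/-! ### The bridge: printed class (10) ⇒ CMI-errata class, by a Galilean boost -/

section Bridge

variable {ι : Type*} [Fintype ι] [DecidableEq ι]
variable {ν : ℝ} {f u : ℝ → EuclideanSpace ℝ ι → EuclideanSpace ℝ ι}
  {u₀ : EuclideanSpace ℝ ι → EuclideanSpace ℝ ι} {p : ℝ → EuclideanSpace ℝ ι → ℝ}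

/-- **Pressure normalisation by a Galilean boost (Tao 2013, §3 eq. (galilean) with Lemma 4.1 (ii)).**
Let `(u, p)` be smooth on `ℝ^ι × [0,∞)` and solve Fefferman's (1)–(3) with viscosity `ν`, datum `u₀`
and a force `f` whose slices `f(·, t)`, `t ≥ 0`, are `ℤ^ι`-periodic, with `u(·, t)` periodic for
all `t ≥ 0` (condition (10) AS PRINTED — nothing asked of `p`). Then there is a `C^∞` frame path `ξ`
with `ξ(0) = ξ′(0) = 0` such that the boosted pair
`v(t, y) = u(t, y + ξ(t)) − ξ′(t)`, `q(t, y) = p(t, y + ξ(t)) + ⟪ξ″(t), y⟫` is smooth on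
`ℝ^ι × [0,∞)`, solves (1)–(3) with the same `ν`, the SAME datum `u₀` and the force
`f(t, y + ξ(t))`, and has `v(·, t)` AND `q(·, t)` periodic for all `t ≥ 0` (the CMI-ERRATA
condition). The frame is the one with acceleration `ξ″ = −a` killing the linear part `x · a(t)` of
the pressure. [cite: Tao2013Localisation, §3 eq. (galilean) and Lemma 4.1 (ii)]
[cite: FeffermanClay2006, (10) and errata] -/
theorem IsNavierStokesSolution.exists_pressurePeriodic_of_velocityPeriodic
    (hns : IsNavierStokesSolution ν f u₀ u p) (hu : IsSmoothOnHalfSpace u)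
    (hp : IsSmoothOnHalfSpace p) (hper : ∀ t, 0 ≤ t → IsLatticePeriodic (u t))
    (hfper : ∀ t, 0 ≤ t → IsLatticePeriodic (f t)) :
    ∃ ξ : ℝ → EuclideanSpace ℝ ι, ContDiff ℝ ∞ ξ ∧ ξ 0 = 0 ∧ deriv ξ 0 = 0 ∧
      IsNavierStokesSolution ν (fun t y => f t (y + ξ t)) u₀ (fun t y => u t (y + ξ t) - deriv ξ t)
          (fun t y => p t (y + ξ t) + ⟪deriv (deriv ξ) t, y⟫) ∧
        IsSmoothOnHalfSpace (fun t y => u t (y + ξ t) - deriv ξ t) ∧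
        IsSmoothOnHalfSpace (fun t y => p t (y + ξ t) + ⟪deriv (deriv ξ) t, y⟫) ∧
        ∀ t, 0 ≤ t →
          IsLatticePeriodic (fun y => u t (y + ξ t) - deriv ξ t) ∧
            IsLatticePeriodic (fun y => p t (y + ξ t) + ⟪deriv (deriv ξ) t, y⟫) := by
  -- the drift, extended smoothly to the whole line, and the frame killing it
  obtain ⟨a, ha, hadrift⟩ := exists_contDiff_extension_Ici (contDiffOn_pressureDrift hp)
  obtain ⟨ξ, hξ, hξ0, hξ'0, hξ''⟩ := exists_frame_of_acceleration ha
  obtain ⟨hns', hu', hp'⟩ := hns.galileanBoost hu hp hξ hξ0 hξ'0 (g := 0) contDiff_const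
  have hg0 : (fun t y => p t (y + ξ t) + ⟪deriv (deriv ξ) t, y⟫ - (0 : ℝ → ℝ) t) =
      fun t y => p t (y + ξ t) + ⟪deriv (deriv ξ) t, y⟫ := by
    funext t y
    simp
  rw [hg0] at hns' hp'
  refine ⟨ξ, hξ, hξ0, hξ'0, hns', hu', hp', fun t ht => ⟨(hper t ht).galileanBoost_velocity ξ, ?_⟩⟩
  -- the boosted pressure slice is `q(y + ξ t) + const` with `q = p(t,·) − ⟪a(t), ·⟫` periodic
  have hq := hns.isLatticePeriodic_pressure_sub_inner hp hper hfper ht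
  intro j y
  have hqy := hq j (y + ξ t)
  simp only at hqy ⊢
  rw [hξ'' t, hadrift t ht, add_right_comm y _ (ξ t), inner_neg_left, inner_neg_left,
    inner_add_right]
  rw [inner_add_right] at hqy
  linarith

/-- **Pressure normalisation, unforced problem** (`f ≡ 0` is frame invariant): a global smooth
solution of the unforced periodic problem `(ν, u₀)` with periodic velocity slices yields a global
smooth solution of the SAME problem with periodic velocity AND pressure slices.
[cite: Tao2013Localisation, §3 eq. (galilean) and Lemma 4.1 (ii)] [cite: FeffermanClay2006, (10) and errata] -/
theorem IsNavierStokesSolution.exists_pressurePeriodic_of_velocityPeriodic_zero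
    (hns : IsNavierStokesSolution ν 0 u₀ u p) (hu : IsSmoothOnHalfSpace u)
    (hp : IsSmoothOnHalfSpace p) (hper : ∀ t, 0 ≤ t → IsLatticePeriodic (u t)) :
    ∃ (v : ℝ → EuclideanSpace ℝ ι → EuclideanSpace ℝ ι) (q : ℝ → EuclideanSpace ℝ ι → ℝ),
      IsSmoothOnHalfSpace v ∧ IsSmoothOnHalfSpace q ∧ IsNavierStokesSolution ν 0 u₀ v q ∧
        ∀ t, 0 ≤ t → IsLatticePeriodic (v t) ∧ IsLatticePeriodic (q t) := by
  obtain ⟨ξ, -, -, -, hns', hu', hp', hper'⟩ :=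
    hns.exists_pressurePeriodic_of_velocityPeriodic hu hp hper fun _ _ => isLatticePeriodic_const 0
  exact ⟨_, _, hu', hp', hns', hper'⟩

/-- **Printed (10) and the CMI-errata condition give the same solvability for `f ≡ 0`.** The
unforced periodic Cauchy problem `(ν, u₀)` has a solution smooth on `ℝ^ι × [0,∞)` with `u(·,t)`
periodic (`t ≥ 0`) iff it has one with `u(·,t)` and `p(·,t)` periodic. (Tao: normalised pressure
"is equivalent to requiring that the pressure be periodic"; the converse direction is trivial.)
[cite: Tao2013Localisation, footnote to eq. (1.8) and §1 after Prop. 1.7] [cite: FeffermanClay2006, (10) and errata] -/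
theorem exists_velocityPeriodic_iff_exists_pressurePeriodic (ν : ℝ)
    (u₀ : EuclideanSpace ℝ ι → EuclideanSpace ℝ ι) :
    (∃ (u : ℝ → EuclideanSpace ℝ ι → EuclideanSpace ℝ ι) (p : ℝ → EuclideanSpace ℝ ι → ℝ),
        IsSmoothOnHalfSpace u ∧ IsSmoothOnHalfSpace p ∧ IsNavierStokesSolution ν 0 u₀ u p ∧
          ∀ t, 0 ≤ t → IsLatticePeriodic (u t)) ↔
      ∃ (u : ℝ → EuclideanSpace ℝ ι → EuclideanSpace ℝ ι) (p : ℝ → EuclideanSpace ℝ ι → ℝ),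
        IsSmoothOnHalfSpace u ∧ IsSmoothOnHalfSpace p ∧ IsNavierStokesSolution ν 0 u₀ u p ∧
          ∀ t, 0 ≤ t → IsLatticePeriodic (u t) ∧ IsLatticePeriodic (p t) := by
  constructor
  · rintro ⟨u, p, hu, hp, hns, hper⟩
    exact hns.exists_pressurePeriodic_of_velocityPeriodic_zero hu hp hper
  · rintro ⟨u, p, hu, hp, hns, hper⟩
    exact ⟨u, p, hu, hp, hns, fun t ht => (hper t ht).1⟩

end Bridge

/-! ### Local-in-time form: classical solutions on a time set `S`, and on `[0, T)` -/

section Local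

variable {F : Type*} [NormedAddCommGroup F] [NormedSpace ℝ F] [CompleteSpace F]

/-- **A `C^∞` function on `[0, T)` (one-sided at `0`) extends to a `C^∞` function on the open
half-line `(−∞, T)`** — the tree's Seeley extension `contDiffOn_extend` with slab height `δ = T`,
applied to `(t, x) ↦ c t`. [cite: Seeley1964, Theorem] -/
theorem exists_contDiffOn_extension_Ico {c : ℝ → F} {T : ℝ} (hT : 0 < T)
    (hc : ContDiffOn ℝ ∞ c (Ico 0 T)) :
    ∃ c' : ℝ → F, ContDiffOn ℝ ∞ c' (Iio T) ∧ ∀ t ∈ Ico 0 T, c' t = c t := by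
  set G : ℝ × ℝ → F := fun z => c z.1 with hGdef
  have hG : ContDiffOn ℝ ∞ G (Literature.Analysis.Calculus.Seeley.slab T (univ : Set ℝ)) :=
    hc.comp contDiffOn_fst fun z hz => hz.1
  have hext := Literature.Analysis.Calculus.Seeley.contDiffOn_extend hT isOpen_univ hG
  refine ⟨fun t => Literature.Analysis.Calculus.Seeley.extend T G (t, 0), ?_, fun t ht => ?_⟩
  · exact hext.comp (contDiffOn_id.prodMk contDiffOn_const) fun s hs => mk_mem_prod hs (mem_univ _)
  · exact Literature.Analysis.Calculus.Seeley.extend_of_nonneg (show (0 : ℝ) ≤ (t, (0 : ℝ)).1 from ht.1)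

/-- The primitive `t ↦ ∫₀ᵗ φ` of a function `C^∞` on the open half-line `(−∞, T)`, `T > 0`, is
`C^∞` there with derivative `φ` (private plumbing). [folklore] -/
private theorem contDiffOn_primitive_Iio {T : ℝ} (hT : 0 < T) {φ : ℝ → F}
    (hφ : ContDiffOn ℝ ∞ φ (Iio T)) :
    ContDiffOn ℝ ∞ (fun t => ∫ s in (0 : ℝ)..t, φ s) (Iio T) ∧
      ∀ t ∈ Iio T, HasDerivAt (fun t => ∫ s in (0 : ℝ)..t, φ s) (φ t) t := by
  have hcont : ContinuousOn φ (Iio T) := hφ.continuousOn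
  have hd : ∀ t ∈ Iio T, HasDerivAt (fun t => ∫ s in (0 : ℝ)..t, φ s) (φ t) t := fun t ht => by
    refine intervalIntegral.integral_hasDerivAt_right ?_
      (hcont.stronglyMeasurableAtFilter isOpen_Iio t ht) (hcont.continuousAt (Iio_mem_nhds ht))
    refine (hcont.mono fun x hx => ?_).intervalIntegrable
    exact lt_of_le_of_lt hx.2 (max_lt hT ht)
  refine ⟨?_, hd⟩
  rw [contDiffOn_infty_iff_deriv_of_isOpen isOpen_Iio]
  exact ⟨fun t ht => (hd t ht).differentiableAt.differentiableWithinAt,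
    hφ.congr fun t ht => (hd t ht).deriv⟩

/-- **The frame with prescribed acceleration, local form**: for `c'` of class `C^∞` on `(−∞, T)`,
`T > 0`, there is `ξ`, `C^∞` on `(−∞, T)`, with `ξ(0) = 0`, `ξ′(0) = 0`, `ξ″ = −c'` on `(−∞, T)`
(private plumbing). [folklore] -/
private theorem exists_frameOn_of_acceleration {T : ℝ} (hT : 0 < T) {c' : ℝ → F}
    (hc' : ContDiffOn ℝ ∞ c' (Iio T)) :
    ∃ ξ : ℝ → F, ContDiffOn ℝ ∞ ξ (Iio T) ∧ ξ 0 = 0 ∧ deriv ξ 0 = 0 ∧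
      ∀ t ∈ Iio T, deriv (deriv ξ) t = -c' t := by
  obtain ⟨hΦ, hΦ'⟩ := contDiffOn_primitive_Iio hT hc'
  obtain ⟨hΨ, hΨ'⟩ := contDiffOn_primitive_Iio hT hΦ
  have hξ' : ∀ t ∈ Iio T,
      HasDerivAt (fun t => -∫ s in (0 : ℝ)..t, ∫ r in (0 : ℝ)..s, c' r) (-∫ r in (0 : ℝ)..t, c' r) t :=
    fun t ht => (hΨ' t ht).neg
  refine ⟨fun t => -∫ s in (0 : ℝ)..t, ∫ r in (0 : ℝ)..s, c' r, hΨ.neg, by simp, ?_, fun t ht => ?_⟩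
  · rw [(hξ' 0 hT).deriv]
    simp
  · have hev : deriv (fun t => -∫ s in (0 : ℝ)..t, ∫ r in (0 : ℝ)..s, c' r) =ᶠ[𝓝 t]
        fun s => -∫ r in (0 : ℝ)..s, c' r := by
      filter_upwards [Iio_mem_nhds ht] with s hs
      exact (hξ' s hs).deriv
    have hΦneg : HasDerivAt (fun s => -∫ r in (0 : ℝ)..s, c' r) (-c' t) t := (hΦ' t ht).neg
    rw [hev.deriv_eq, hΦneg.deriv]

variable {ι : Type*} [Fintype ι] [DecidableEq ι]
variable {S : Set ℝ} {ν : ℝ} {f u : ℝ → EuclideanSpace ℝ ι → EuclideanSpace ℝ ι}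
  {p : ℝ → EuclideanSpace ℝ ι → ℝ}

/-- **Periodic gradient of the pressure, classical solutions on a time set `S`**: for a classical
solution on `S × ℝ^ι` with `u(·,t)` and `f(·,t)` periodic (`t ∈ S`), `∇p(·,t)` is periodic, `t ∈ S`
(momentum equation: every other term is periodic). [cite: Tao2013Localisation, Lemma 4.1 (ii)] -/
theorem IsClassicalNSSolutionOn.isLatticePeriodic_gradient_pressure
    (h : IsClassicalNSSolutionOn S ν f u p) (hper : ∀ t ∈ S, IsLatticePeriodic (u t))
    (hfper : ∀ t ∈ S, IsLatticePeriodic (f t)) {t : ℝ} (ht : t ∈ S) :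
    IsLatticePeriodic (gradient (p t)) := by
  intro j x
  set e : EuclideanSpace ℝ ι := EuclideanSpace.single j 1 with he
  have hshift : (fun z => u t (z + e)) = u t := funext fun z => hper t ht j z
  have hg : ∀ y, gradient (p t) y = ν • (Δ (u t)) y + f t y -
      (timeDerivWithin S u t y + convect (u t) (u t) y) := fun y => by
    rw [h.momentum t ht y]
    abel
  have h1 : (Δ (u t)) (x + e) = (Δ (u t)) x := by
    rw [← laplacian_comp_add_right (u t) e x, hshift]
  have h2 : f t (x + e) = f t x := hfper t ht j x
  have h3 : timeDerivWithin S u t (x + e) = timeDerivWithin S u t x := by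
    rw [timeDerivWithin_apply, timeDerivWithin_apply]
    exact derivWithin_congr (fun s hs => hper s hs j x) (hper t ht j x)
  have h4 : convect (u t) (u t) (x + e) = convect (u t) (u t) x := by
    rw [convect_apply, convect_apply, ← fderiv_comp_add_right e, hshift, hper t ht j x]
  rw [hg, hg, h1, h2, h3, h4]

/-- **A smooth function with periodic gradient is periodic plus linear**: if `q : ℝ^ι → ℝ` is
differentiable and `∇q` is `ℤ^ι`-periodic then `y ↦ q y − ⟪∑ⱼ (q(eⱼ) − q(0)) eⱼ, y⟫` is periodic
(the lattice increments of `q` are constant, `is_const_of_fderiv_eq_zero`; the elementary half of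
Tao's Lemma 4.1 (ii), stated for one slice). [cite: Tao2013Localisation, Lemma 4.1 (ii)] -/
theorem isLatticePeriodic_sub_inner_of_gradient {q : EuclideanSpace ℝ ι → ℝ}
    (hqd : Differentiable ℝ q) (hgrad : IsLatticePeriodic (gradient q)) :
    IsLatticePeriodic (fun y => q y -
      ⟪∑ j, (q (EuclideanSpace.single j 1) - q 0) • EuclideanSpace.single j (1 : ℝ), y⟫) := by
  intro j y
  set e : EuclideanSpace ℝ ι := EuclideanSpace.single j 1 with he
  have hconst : q (y + e) - q y = q e - q 0 := by
    have hd1 : ∀ z, DifferentiableAt ℝ (fun z => q (z + e)) z := fun z =>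
      (hqd (z + e)).comp z (differentiableAt_id.add_const e)
    have hd : Differentiable ℝ (fun z => q (z + e) - q z) := fun z => (hd1 z).sub (hqd z)
    have hd' : ∀ z, fderiv ℝ (fun z => q (z + e) - q z) z = 0 := fun z => by
      have hfd : fderiv ℝ q (z + e) = fderiv ℝ q z := by
        have hgz := hgrad j z
        change (toDual ℝ (EuclideanSpace ℝ ι)).symm (fderiv ℝ q (z + e)) =
          (toDual ℝ (EuclideanSpace ℝ ι)).symm (fderiv ℝ q z) at hgz
        exact (toDual ℝ (EuclideanSpace ℝ ι)).symm.injective hgz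
      rw [fderiv_fun_sub (hd1 z) (hqd z), fderiv_comp_add_right e, hfd, sub_self]
    have := is_const_of_fderiv_eq_zero hd hd' y 0
    simpa using this
  have hinner : ⟪∑ i, (q (EuclideanSpace.single i 1) - q 0) • EuclideanSpace.single i (1 : ℝ), e⟫ =
      q e - q 0 := by
    simp [he, sum_inner, EuclideanSpace.inner_single_right]
  show q (y + e) - ⟪_, y + e⟫ = q y - ⟪_, y⟫
  rw [inner_add_right, hinner]
  linarith [hconst]

/-- **Lemma 4.1 (ii), elementary half, for classical solutions on `S`**: `p(·,t) − ⟪pressureDrift p t, ·⟫`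
is periodic for `t ∈ S`. [cite: Tao2013Localisation, Lemma 4.1 (ii)] -/
theorem IsClassicalNSSolutionOn.isLatticePeriodic_pressure_sub_inner
    (h : IsClassicalNSSolutionOn S ν f u p) (hper : ∀ t ∈ S, IsLatticePeriodic (u t))
    (hfper : ∀ t ∈ S, IsLatticePeriodic (f t)) {t : ℝ} (ht : t ∈ S) :
    IsLatticePeriodic (fun y => p t y - ⟪pressureDrift p t, y⟫) :=
  isLatticePeriodic_sub_inner_of_gradient ((h.contDiff_pressure ht).differentiable (by simp))
    (h.isLatticePeriodic_gradient_pressure hper hfper ht)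

/-- The drift of the pressure of a classical solution on `S` is `C^∞` on `S` (one-sided where `S`
is). [cite: Tao2013Localisation, Lemma 4.1 (ii)] -/
theorem IsClassicalNSSolutionOn.contDiffOn_pressureDrift (h : IsClassicalNSSolutionOn S ν f u p) :
    ContDiffOn ℝ ∞ (pressureDrift p) S := by
  have hline : ∀ y₀ : EuclideanSpace ℝ ι, ContDiffOn ℝ ∞ (fun t => p t y₀) S := fun y₀ =>
    h.smooth_pressure.comp (contDiffOn_id.prodMk contDiffOn_const)
      fun s hs => mk_mem_prod hs (mem_univ _)
  unfold pressureDrift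
  exact ContDiffOn.sum fun j _ => ((hline _).sub (hline 0)).smul contDiffOn_const

/-- **Pressure normalisation on `[0, T)` (the life span of a would-be blow-up solution).** A
classical solution on `ℝ^ι × [0,T)` (`T > 0`) of (1)–(2) with viscosity `ν`, force `f` periodic in
`x`, and `u(·,t)` periodic (`0 ≤ t < T`) is carried by a Galilean boost with frame `ξ` smooth on
`(−∞, T)`, `ξ(0) = ξ′(0) = 0`, `ξ″ = −a` (the extended pressure drift) to a classical solution on
`[0,T)` with the SAME time-`0` slice, force `f(t, · + ξ t)`, and `u(·,t)` AND `p(·,t)` periodic.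
(Tree: `IsClassicalNSSolutionOn.galileanBoostOn` with `U = (−∞, T)`.)
[cite: Tao2013Localisation, §3 eq. (galilean) and Lemma 4.1 (ii)] [cite: FeffermanClay2006, (10) and errata] -/
theorem IsClassicalNSSolutionOn.exists_pressurePeriodic_of_velocityPeriodic_Ico {T : ℝ} (hT : 0 < T)
    (h : IsClassicalNSSolutionOn (Ico 0 T) ν f u p)
    (hper : ∀ t ∈ Ico 0 T, IsLatticePeriodic (u t))
    (hfper : ∀ t ∈ Ico 0 T, IsLatticePeriodic (f t)) :
    ∃ ξ : ℝ → EuclideanSpace ℝ ι, ContDiffOn ℝ ∞ ξ (Iio T) ∧ ξ 0 = 0 ∧ deriv ξ 0 = 0 ∧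
      IsClassicalNSSolutionOn (Ico 0 T) ν (fun t y => f t (y + ξ t))
          (fun t y => u t (y + ξ t) - deriv ξ t) (fun t y => p t (y + ξ t) + ⟪deriv (deriv ξ) t, y⟫) ∧
        (fun t y => u t (y + ξ t) - deriv ξ t) 0 = u 0 ∧
        ∀ t ∈ Ico 0 T,
          IsLatticePeriodic (fun y => u t (y + ξ t) - deriv ξ t) ∧
            IsLatticePeriodic (fun y => p t (y + ξ t) + ⟪deriv (deriv ξ) t, y⟫) := by
  obtain ⟨a, ha, hadrift⟩ := exists_contDiffOn_extension_Ico hT h.contDiffOn_pressureDrift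
  obtain ⟨ξ, hξ, hξ0, hξ'0, hξ''⟩ := exists_frameOn_of_acceleration hT ha
  have hb := h.galileanBoostOn (uniqueDiffOn_Ico 0 T) isOpen_Iio (fun t ht => ht.2) hξ
    (g := 0) contDiffOn_const
  have hg0 : (fun t y => p t (y + ξ t) + ⟪deriv (deriv ξ) t, y⟫ - (0 : ℝ → ℝ) t) =
      fun t y => p t (y + ξ t) + ⟪deriv (deriv ξ) t, y⟫ := by
    funext t y
    simp
  rw [hg0] at hb
  refine ⟨ξ, hξ, hξ0, hξ'0, hb, ?_, fun t ht => ⟨(hper t ht).galileanBoost_velocity ξ, ?_⟩⟩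
  · funext y
    simp [hξ0, hξ'0]
  · have hq := h.isLatticePeriodic_pressure_sub_inner hper hfper ht
    intro j y
    have hqy := hq j (y + ξ t)
    simp only at hqy ⊢
    rw [hξ'' t ht.2, hadrift t ht, add_right_comm y _ (ξ t), inner_neg_left, inner_neg_left,
      inner_add_right]
    rw [inner_add_right] at hqy
    linarith

/-- **Pressure normalisation on `[0, T)`, unforced problem**: a classical solution of the unforced
system on `ℝ^ι × [0,T)` with periodic velocity slices yields one with the same time-`0` slice and
periodic velocity AND pressure slices. [cite: Tao2013Localisation, §3 eq. (galilean) and Lemma 4.1 (ii)]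
[cite: FeffermanClay2006, (10) and errata] -/
theorem IsClassicalNSSolutionOn.exists_pressurePeriodic_of_velocityPeriodic_Ico_zero {T : ℝ}
    (hT : 0 < T) {u : ℝ → EuclideanSpace ℝ ι → EuclideanSpace ℝ ι} {p : ℝ → EuclideanSpace ℝ ι → ℝ}
    (h : IsClassicalNSSolutionOn (Ico 0 T) ν 0 u p)
    (hper : ∀ t ∈ Ico 0 T, IsLatticePeriodic (u t)) :
    ∃ (v : ℝ → EuclideanSpace ℝ ι → EuclideanSpace ℝ ι) (q : ℝ → EuclideanSpace ℝ ι → ℝ),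
      IsClassicalNSSolutionOn (Ico 0 T) ν 0 v q ∧ v 0 = u 0 ∧
        ∀ t ∈ Ico 0 T, IsLatticePeriodic (v t) ∧ IsLatticePeriodic (q t) := by
  obtain ⟨ξ, -, -, -, hb, h0, hper'⟩ :=
    h.exists_pressurePeriodic_of_velocityPeriodic_Ico hT hper fun _ _ => isLatticePeriodic_const 0
  exact ⟨_, _, hb, h0, hper'⟩

end Local

end Literature.Analysis.FluidPDE

end

-- WHAT THIS IS NOT: not a claim about NS regularity or blow-up; not a claim about any author beyond the typed locator.
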